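import Summits.Ventures.LatticeQCDFlow.Scoring.NonabelianAreaLaw2DWilsonLoop
import HarnessLib

/-!
# The exact non-abelian area law in two dimensions, VI: two NESTED loops at once — `∫ ρ(W_{R×T})_{ab} σ(W_{R'×T})_{cd} ∏_p w(U_p) = (M_ρ^{(R−R')T} · M_{ρ⊗σ}^{R'T})`

HONEST FRAMING: exact (Metropolis-corrected) sampling algorithms for lattice gauge theory;
figures of merit are autocorrelation/cost numbers at stated couplings and volumes; no
continuum-physics claim.

Venture `LatticeQCDFlow` (cell pub-lqcd), sub-topic `Scoring`; FANOUT row 5 (`s0-sun-a`), GEN-21.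
NEW WORK of the cell (placement rule).  GEN-18's matrix area law (`NonabelianAreaLaw2DWilsonLoop` §4) handles one
loop, GEN-21's §5 two representations of the SAME loop.  Here: two loops `W = W_{R×T}` and `W' = W_{R'×T}` with the
same corner `(i, j)` and the same height `T`, the smaller width `R' ≤ R` (so `W'` is the left part of `W`), in two
continuous representations `ρ` (on `Fin N`) and `σ` (on any finite index type), weighted by the one-plaquette class
weights on the plaquettes enclosed by the LARGER loop — for every compact `G`:

  **`∫ ρ(W)_{ab} σ(W')_{cd} ∏_{p ∈ B_{R×T}} w(U_p) dHaar^{⊗E} = Σ_{d'} (M_ρ^{(R−R')T})_{a d'} · (M_{ρ⊗σ}^{R'T})_{(d',c),(b,d)}`**,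

`M_ρ = ∫ ρ(g) w(g) dg`, `M_{ρ⊗σ} = ∫ (ρ(g) ⊗ₖ σ(g)) w(g) dg` (`integral_rep_rectangleHolonomy_mul_rep_inner_mul_prod_weight`,
stated with `R = R' + k`).  Proof: induction on `k`; the base `k = 0` is §5's Kronecker area law; the step is
§4's step verbatim — the added column's private links are not seen by the inner loop `W'` (it lies `k + 1 ≥ 1`
columns to the left of them), so `σ(W')_{cd}` rides along in the private-link-independent scalar factor of part I's
column absorption `integral_listProd_words_mul`.  With `M_ρ = c·1` (Schur, defining representations) the trace form
is `∫ tr ρ(W) tr σ(W') ∏w = c^{(R−R')T} · tr(M_{ρ⊗σ}^{R'T})`-type sums — the input of the exact covariance of two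
nested Wilson loops (Creutz-ratio error propagation; sequel for `U(N)`).

No `def`, nothing cited as a fact, 0 sorry.
-/

noncomputable section

open MeasureTheory Function Finset
open Literature.MathematicalPhysics.QuantumFieldTheory
open Summit.Ventures.LatticeQCDFlow.Theory2.Lattice
open Summit.Ventures.LatticeQCDFlow.Theory2.Lattice.TwoDim
open scoped Kronecker

namespace Summit.Ventures.LatticeQCDFlow.Scoring

variable {L : ℕ} [NeZero L] {G : Type*} [Group G] [TopologicalSpace G] [IsTopologicalGroup G]
  [CompactSpace G] [SecondCountableTopology G] [MeasurableSpace G] [BorelSpace G]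

section Nested

/-- **THE MATRIX AREA LAW FOR TWO NESTED LOOPS** (every compact gauge group, continuous representations `ρ`, `σ`,
continuous class weight).  On `(ℤ/L)²`, for the loops `W = W_{(R'+k)×T}` and `W' = W_{R'×T}` with common corner
`(i, j)` (`R' + k + 1 ≤ L`, `T + 1 ≤ L`) and the weights on the plaquettes enclosed by `W`:
`∫ ρ(W)_{ab} σ(W')_{cd} ∏_p w(U_p) dHaar^{⊗E} = Σ_{d'} (M_ρ^{kT})_{a d'} (M_{ρ⊗σ}^{R'T})_{(d',c),(b,d)}`. -/
theorem integral_rep_rectangleHolonomy_mul_rep_inner_mul_prod_weight {N : ℕ} {m : Type*} [Fintype m]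
    [DecidableEq m] (ρ : G →* Matrix (Fin N) (Fin N) ℂ) (σ : G →* Matrix m m ℂ) (hρ : Continuous ρ)
    (hσ : Continuous σ) {w : G → ℝ} (hw : Continuous w) (hwc : ∀ k g, w (k * g * k⁻¹) = w g)
    (i j : ZMod L) {T : ℕ} (hT : T + 1 ≤ L) (R' : ℕ) (c₀ d₀ : m) :
    ∀ (k : ℕ), R' + k + 1 ≤ L → ∀ a b : Fin N,
      ∫ U, ρ (rectangleHolonomy U ![i, j] 0 1 (R' + k) T) a b *
          σ (rectangleHolonomy U ![i, j] 0 1 R' T) c₀ d₀ *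
          ∏ p ∈ (range (R' + k) ×ˢ range T).image (fun q : ℕ × ℕ => (![i + q.1, j + q.2] : Site 2 L)),
            (w (plaquetteHolonomy U p 0 1) : ℂ) ∂(Measure.pi fun _ : Edge 2 L => haarProbability G) =
        ∑ d' : Fin N, ((Matrix.of fun k l : Fin N => ∫ g, ρ g k l * (w g : ℂ) ∂(haarProbability G)) ^ (k * T)) a d' *
          ((Matrix.of fun k l : Fin N × m => ∫ g, (ρ g ⊗ₖ σ g) k l * (w g : ℂ) ∂(haarProbability G)) ^ (R' * T))
            (d', c₀) (b, d₀) := by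
  intro k
  induction k with
  | zero =>
    intro hR a b
    simp only [Nat.add_zero, zero_mul, pow_zero, Matrix.one_apply, ite_mul, one_mul, zero_mul,
      Finset.sum_ite_eq, Finset.mem_univ, if_true]
    exact integral_rep_mul_rep_rectangleHolonomy_mul_prod_weight ρ σ hρ hσ hw hwc i j hT (by omega) a b c₀ d₀
  | succ k ih =>
    intro hRk a b
    rw [show R' + (k + 1) = R' + k + 1 by omega]
    set R := R' + k with hRdef
    set M : Matrix (Fin N) (Fin N) ℂ :=
      Matrix.of fun k l : Fin N => ∫ g, ρ g k l * (w g : ℂ) ∂(haarProbability G) with hM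
    set X : Matrix (Fin N × m) (Fin N × m) ℂ :=
      (Matrix.of fun k l : Fin N × m => ∫ g, (ρ g ⊗ₖ σ g) k l * (w g : ℂ) ∂(haarProbability G)) ^ (R' * T) with hX
    have hR : R + 2 ≤ L := by omega
    have ih' := ih (show R' + k + 1 ≤ L by omega)
    have hTL : T ≤ L := by omega
    haveI : Fact (1 < L) := ⟨by omega⟩
    -- facts about columns mod `L`
    have hz2 : (i + R : ZMod L) ≠ i + R + 1 := fun h => one_ne_zero (left_eq_add.mp h)
    have hz3 : (i : ZMod L) ≠ i + R + 1 := by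
      intro h
      rw [add_assoc] at h
      have h' : ((R + 1 : ℕ) : ZMod L) = ((0 : ℕ) : ZMod L) := by
        push_cast; exact (left_eq_add.mp h)
      exact natCast_zmod_ne_of_lt (L := L) (j := R + 1) (k := 0) (by omega) (by omega) (by omega) h'
    have hz4 : (i + R' : ZMod L) ≠ i + R + 1 := by
      intro h
      rw [hRdef, Nat.cast_add, add_assoc, add_assoc] at h
      have h' : ((R' : ℕ) : ZMod L) = ((R' + (k + 1) : ℕ) : ZMod L) := by
        push_cast; exact add_left_cancel h
      exact natCast_zmod_ne_of_lt (L := L) (j := R') (k := R' + (k + 1)) (by omega) (by omega) (by omega) h'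
    -- the column data: private links `e c`, words `A c · U_{e c} · B c`
    let e : ℕ → Edge 2 L := fun c => (![i + R + 1, j + c], 1)
    let A : ℕ → GaugeConfig 2 L G → G := fun c U =>
      lineHolonomy U 0 R ![i, j] * lineHolonomy U 1 c ![i + R, j] * U (![i + R, j + c], 0)
    let B : ℕ → GaugeConfig 2 L G → G := fun c U =>
      (U (![i + R, j + c + 1], 0))⁻¹ * (U (![i + R, j + c], 1))⁻¹ * (lineHolonomy U 1 c ![i + R, j])⁻¹ *
        (lineHolonomy U 0 R ![i, j])⁻¹
    let Ψ : GaugeConfig 2 L G → ℂ := fun U =>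
      (∏ p ∈ (range R ×ˢ range T).image (fun q : ℕ × ℕ => (![i + q.1, j + q.2] : Site 2 L)),
        (w (plaquetteHolonomy U p 0 1) : ℂ)) * σ (rectangleHolonomy U ![i, j] 0 1 R' T) c₀ d₀
    have he : ∀ c < T, ∀ c' < T, e c = e c' → c = c' := by
      intro c hc c' hc' h
      have h1 : (![i + R + 1, j + c] : Site 2 L) = ![i + R + 1, j + c'] := congrArg Prod.fst h
      have h2 := add_left_cancel (vec2_eq_iff.mp h1).2
      by_contra hne
      exact natCast_zmod_ne_of_lt (L := L) (by omega) (by omega) hne h2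
    have hA : ∀ c, Continuous (A c) := fun c => by
      show Continuous fun U : GaugeConfig 2 L G =>
        lineHolonomy U 0 R ![i, j] * lineHolonomy U 1 c ![i + R, j] * U (![i + R, j + c], 0)
      exact ((continuous_config_lineHolonomy 0 R _).mul (continuous_config_lineHolonomy 1 c _)).mul
        (continuous_apply _)
    have hev : ∀ e' : Edge 2 L, Continuous fun U : GaugeConfig 2 L G => U e' := fun e' => continuous_apply e'
    have hB : ∀ c, Continuous (B c) := fun c => by
      show Continuous fun U : GaugeConfig 2 L G =>
        (U (![i + R, j + c + 1], 0))⁻¹ * (U (![i + R, j + c], 1))⁻¹ * (lineHolonomy U 1 c ![i + R, j])⁻¹ *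
          (lineHolonomy U 0 R ![i, j])⁻¹
      exact (((hev ((![i + R, j + c + 1], 0) : Edge 2 L)).inv.mul
        (hev ((![i + R, j + c], 1) : Edge 2 L)).inv).mul
        (continuous_config_lineHolonomy (1 : Fin 2) c (![i + R, j] : Site 2 L)).inv).mul
        (continuous_config_lineHolonomy (0 : Fin 2) R (![i, j] : Site 2 L)).inv
    have hh : ∀ c c' : ℕ, ((![i + R, j + c], 0) : Edge 2 L) ≠ (![i + R + 1, j + c'], 1) := by
      intro c c' h
      have h2 : (0 : Fin 2) = 1 := congrArg Prod.snd h
      exact absurd h2 (by decide)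
    have hh' : ∀ c c' : ℕ, ((![i + R, j + c + 1], 0) : Edge 2 L) ≠ (![i + R + 1, j + c'], 1) := by
      intro c c' h
      have h2 : (0 : Fin 2) = 1 := congrArg Prod.snd h
      exact absurd h2 (by decide)
    have hv : ∀ c c' : ℕ, ((![i + R, j + c], 1) : Edge 2 L) ≠ (![i + R + 1, j + c'], 1) :=
      fun c c' h => hz2 (vec2_eq_iff.mp (congrArg Prod.fst h)).1
    have hAe : ∀ c c' U g, A c (update U (e c') g) = A c U := by
      intro c c' U g
      show lineHolonomy (update U (![i + R + 1, j + c'], 1) g) 0 R ![i, j] *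
          lineHolonomy (update U (![i + R + 1, j + c'], 1) g) 1 c ![i + R, j] *
          update U (![i + R + 1, j + c'], 1) g (![i + R, j + c], 0) = _
      rw [lineHolonomy_update_of_snd_ne (k := 0) (k' := 1) (by decide), lineHolonomy_one_update_of_fst_ne hz2,
        update_of_ne (hh c c')]
    have hBe : ∀ c c' U g, B c (update U (e c') g) = B c U := by
      intro c c' U g
      show (update U (![i + R + 1, j + c'], 1) g (![i + R, j + c + 1], 0))⁻¹ *
          (update U (![i + R + 1, j + c'], 1) g (![i + R, j + c], 1))⁻¹ *
          (lineHolonomy (update U (![i + R + 1, j + c'], 1) g) 1 c ![i + R, j])⁻¹ *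
          (lineHolonomy (update U (![i + R + 1, j + c'], 1) g) 0 R ![i, j])⁻¹ = _
      rw [update_of_ne (hh' c c'), update_of_ne (hv c c'), lineHolonomy_one_update_of_fst_ne hz2,
        lineHolonomy_update_of_snd_ne (k := 0) (k' := 1) (by decide)]
    have hK : Continuous fun U : GaugeConfig 2 L G => ρ (rectangleHolonomy U ![i, j] 0 1 R T) :=
      hρ.comp (continuous_config_rectangleHolonomy _ 0 1 R T)
    have hKe : ∀ c U g, (fun U : GaugeConfig 2 L G => ρ (rectangleHolonomy U ![i, j] 0 1 R T))
        (update U (e c) g) = ρ (rectangleHolonomy U ![i, j] 0 1 R T) := by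
      intro c U g
      show ρ (rectangleHolonomy (update U (![i + R + 1, j + c], 1) g) ![i, j] 0 1 R T) = _
      rw [rectangleHolonomy_update_col i j R T hz3 hz2]
    have hΨ : Continuous Ψ :=
      (continuous_finsetProd _ fun p _ =>
        Complex.continuous_ofReal.comp (hw.comp (continuous_config_plaquetteHolonomy p 0 1))).mul
        ((hσ.comp (continuous_config_rectangleHolonomy _ 0 1 R' T)).matrix_elem c₀ d₀)
    have hΨe : ∀ c U g, Ψ (update U (e c) g) = Ψ U := by
      intro c U g
      show (∏ p ∈ (range R ×ˢ range T).image (fun q : ℕ × ℕ => (![i + q.1, j + q.2] : Site 2 L)),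
          (w (plaquetteHolonomy (update U (![i + R + 1, j + c], 1) g) p 0 1) : ℂ)) *
          σ (rectangleHolonomy (update U (![i + R + 1, j + c], 1) g) ![i, j] 0 1 R' T) c₀ d₀ = _
      rw [rectangleHolonomy_update_col i j R' T hz3 hz4]
      congr 1
      exact Finset.prod_congr rfl fun p hp => by
        rw [plaquetteHolonomy_update_col_of_mem_rect i j hR hp]
    -- each word is the transported plaquette of the new column
    have hconj : ∀ (c : ℕ) (U : GaugeConfig 2 L G), A c U * U (e c) * B c U =
        (lineHolonomy U 0 R ![i, j] * lineHolonomy U 1 c ![i + R, j]) *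
          plaquetteHolonomy U ![i + R, j + c] 0 1 *
          (lineHolonomy U 0 R ![i, j] * lineHolonomy U 1 c ![i + R, j])⁻¹ := by
      intro c U
      simp only [A, B, e, plaquetteHolonomy, shift_vec2_zero, shift_vec2_one]
      group
    -- pointwise: the integrand in the shape of part I §2
    have hpt0 : ∀ U : GaugeConfig 2 L G,
        ρ (rectangleHolonomy U ![i, j] 0 1 (R + 1) T) a b *
            ∏ p ∈ (range (R + 1) ×ˢ range T).image (fun q : ℕ × ℕ => (![i + q.1, j + q.2] : Site 2 L)),
              (w (plaquetteHolonomy U p 0 1) : ℂ) =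
          (((List.range T).map fun c => ρ (A c U * U (e c) * B c U)).prod *
              ρ (rectangleHolonomy U ![i, j] 0 1 R T)) a b *
            ((∏ c ∈ range T, (w (A c U * U (e c) * B c U) : ℂ)) *
              ∏ p ∈ (range R ×ˢ range T).image (fun q : ℕ × ℕ => (![i + q.1, j + q.2] : Site 2 L)),
                (w (plaquetteHolonomy U p 0 1) : ℂ)) := by
      intro U
      rw [prod_rect_succ_eq i j (R := R) (T := T) (by omega) hTL, rectangleHolonomy_succ_eq_listProd_mul, map_mul,
        map_list_prod, List.map_map]
      congr 2
      refine Finset.prod_congr rfl fun c _ => ?_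
      rw [hconj, hwc]
    have hpt : ∀ U : GaugeConfig 2 L G,
        ρ (rectangleHolonomy U ![i, j] 0 1 (R + 1) T) a b *
            σ (rectangleHolonomy U ![i, j] 0 1 R' T) c₀ d₀ *
            ∏ p ∈ (range (R + 1) ×ˢ range T).image (fun q : ℕ × ℕ => (![i + q.1, j + q.2] : Site 2 L)),
              (w (plaquetteHolonomy U p 0 1) : ℂ) =
          (((List.range T).map fun c => ρ (A c U * U (e c) * B c U)).prod *
              ρ (rectangleHolonomy U ![i, j] 0 1 R T)) a b *
            ((∏ c ∈ range T, (w (A c U * U (e c) * B c U) : ℂ)) * Ψ U) := by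
      intro U
      rw [mul_right_comm, hpt0 U]
      simp only [Ψ]
      ring
    have hint : ∀ d : Fin N, Integrable (fun U : GaugeConfig 2 L G =>
        (M ^ T) a d * (ρ (rectangleHolonomy U ![i, j] 0 1 R T) d b * Ψ U))
        (Measure.pi fun _ : Edge 2 L => haarProbability G) := fun d =>
      (integrable_gaugeConfig_of_continuous ((hK.matrix_elem d b).mul hΨ)).const_mul _
    have hsplit : ∀ U : GaugeConfig 2 L G,
        (M ^ T * ρ (rectangleHolonomy U ![i, j] 0 1 R T)) a b * Ψ U =
          ∑ d, (M ^ T) a d * (ρ (rectangleHolonomy U ![i, j] 0 1 R T) d b * Ψ U) := fun U => by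
      rw [Matrix.mul_apply, Finset.sum_mul]
      exact Finset.sum_congr rfl fun d _ => mul_assoc _ _ _
    have hih : ∀ d : Fin N, ∫ U, ρ (rectangleHolonomy U ![i, j] 0 1 R T) d b * Ψ U
        ∂(Measure.pi fun _ : Edge 2 L => haarProbability G) = ∑ d' : Fin N, (M ^ (k * T)) d d' * X (d', c₀) (b, d₀) := by
      intro d
      rw [← ih' d b]
      refine integral_congr_ae (ae_of_all _ fun U => ?_)
      simp only [Ψ]
      ring
    calc ∫ U, ρ (rectangleHolonomy U ![i, j] 0 1 (R + 1) T) a b *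
            σ (rectangleHolonomy U ![i, j] 0 1 R' T) c₀ d₀ *
            ∏ p ∈ (range (R + 1) ×ˢ range T).image (fun q : ℕ × ℕ => (![i + q.1, j + q.2] : Site 2 L)),
              (w (plaquetteHolonomy U p 0 1) : ℂ) ∂(Measure.pi fun _ : Edge 2 L => haarProbability G)
        = ∫ U, (((List.range T).map fun c => ρ (A c U * U (e c) * B c U)).prod *
              ρ (rectangleHolonomy U ![i, j] 0 1 R T)) a b *
            ((∏ c ∈ range T, (w (A c U * U (e c) * B c U) : ℂ)) * Ψ U)
            ∂(Measure.pi fun _ : Edge 2 L => haarProbability G) := integral_congr_ae (ae_of_all _ hpt)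
      _ = ∫ U, (M ^ T * ρ (rectangleHolonomy U ![i, j] 0 1 R T)) a b * Ψ U
            ∂(Measure.pi fun _ : Edge 2 L => haarProbability G) :=
          integral_listProd_words_mul ρ hρ hw T e A B
            (fun U : GaugeConfig 2 L G => ρ (rectangleHolonomy U ![i, j] 0 1 R T)) Ψ he hA hB hAe hBe
            hK hKe hΨ hΨe a b
      _ = ∑ d, (M ^ T) a d * ∫ U, ρ (rectangleHolonomy U ![i, j] 0 1 R T) d b * Ψ U
            ∂(Measure.pi fun _ : Edge 2 L => haarProbability G) := by
          rw [integral_congr_ae (ae_of_all _ hsplit), integral_finsetSum _ fun d _ => hint d]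
          exact Finset.sum_congr rfl fun d _ => integral_const_mul _ _
      _ = ∑ d, (M ^ T) a d * ∑ d' : Fin N, (M ^ (k * T)) d d' * X (d', c₀) (b, d₀) :=
          Finset.sum_congr rfl fun d _ => by rw [hih d]
      _ = ∑ d' : Fin N, (M ^ T * M ^ (k * T)) a d' * X (d', c₀) (b, d₀) := by
          simp_rw [Finset.mul_sum, Matrix.mul_apply, Finset.sum_mul]
          rw [Finset.sum_comm]
          exact Finset.sum_congr rfl fun d' _ => Finset.sum_congr rfl fun d _ => by ring
      _ = ∑ d' : Fin N, (M ^ ((k + 1) * T)) a d' * X (d', c₀) (b, d₀) := by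
          rw [← pow_add, show T + k * T = (k + 1) * T by ring]

end Nested

end Summit.Ventures.LatticeQCDFlow.Scoring
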